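import Literature.MathematicalPhysics.KineticTheory.HardSphereDispersion
import Literature.Analysis.FluidPDE.BBGKYMarginals
import HarnessLib

/-!
# The interacting transport carries the dispersive weight (CIP 1994 §4.5 (5.2)–(5.3))

Topic: MathematicalPhysics / KineticTheory. A brick of the BBGKY side of the convergence half of
the named fact `Literature.MathematicalPhysics.KineticTheory.illner_pulvirenti`
(Cercignani–Illner–Pulvirenti 1994 Thm 4.5.1, Step 3): the hypothesis `htr` of the abstract
global chain estimate `abs_duhamelChain_le_dispersive_of_le` for the transports of the BBGKY
hierarchy of hard spheres in `ℝ^d`.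

For a hard-sphere flow `Φ` on `ℝ^d` (`HardSphereFlow (Euclidean.geometry d) ε s`), the transport
of the BBGKY hierarchy restricted to the good set of the flow — as in `gcEvolved`, value `0` at
the (Liouville-null) bad configurations, where the flow is junk — carries the rare-cloud weight
`e^{-β₀ I(T⁰_{-τ} ·)} e^{-b H}` at time `τ` to `e^{-β₀ I(T⁰_{-t} ·)} e^{-b H}` at time `t ≥ τ`:
if `|g| ≤ K e^{-β₀ I_τ} e^{-b H}` then `|1_good · (g ∘ Φ_{-(t-τ)})| ≤ K e^{-β₀ I_t} e^{-b H}`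
(`HardSphereFlow.abs_indicator_hsTransport_le_dispersive`). This is CIP 1994 (5.3): along the
trajectory through a good configuration, `I(T⁰_{-τ} Φ_{-(t-τ)} Z) ≥ I(T⁰_{-t} Z)` is the
backward dispersion inequality Lemma 4.2.4 (`IsHardSphereTrajectory.sum_norm_sq_sub_smul_le_of_le`
of `HardSphereDispersion`), and the kinetic energy is conserved
(`IsHardSphereTrajectory.configEnergy_eq_holds`). Without the restriction to the good set the
statement is false (off the good set `Φ` is unspecified).

Theorems only.

## References

* C. Cercignani, R. Illner, M. Pulvirenti, *The Mathematical Theory of Dilute Gases*, Applied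
  Mathematical Sciences 106, Springer (1994), §4.5 (5.2)–(5.3), p. 88, and §4.2 Lemma 4.2.4.
-/

open Set Filter Topology Function
open scoped InnerProductSpace

namespace Literature.MathematicalPhysics.KineticTheory

noncomputable section

open Literature.Analysis.FluidPDE

variable {d : Type*} [Fintype d] {s : ℕ} {ε : ℝ}

/-- Along the orbit of a good configuration the flow composes: `Φ_a (Φ_{-t} Z)` at `a = τ` is
`Φ_{-(t-τ)} Z` and at `a = t` is `Z`. [folklore] -/
theorem _root_.Literature.Analysis.FluidPDE.HardSphereFlow.flow_flow_neg_eq (Φ : HardSphereFlow (Euclidean.geometry d) ε s)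
    {Z : Config s d (EuclideanSpace ℝ d)} (hZ : Z ∈ Φ.good) (τ t : ℝ) :
    Φ.flow τ (Φ.flow (-t) Z) = Φ.flow (-(t - τ)) Z := by
  rw [← Φ.flow_add τ (-t) Z hZ]
  congr 1
  ring

/-- **The interacting transport restricted to the good set carries the dispersive weight**
(CIP 1994 §4.5 (5.2)–(5.3) with Lemma 4.2.4): for a hard-sphere flow `Φ` on `ℝ^d`,
`0 ≤ τ ≤ t`, `K ≥ 0`, `β₀ ≥ 0` and `|g(Z)| ≤ K e^{-β₀ ∑|x_k - τ v_k|²} e^{-b H(Z)}` for all `Z`,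
`|1_{good}(Z) · g(Φ_{-(t-τ)} Z)| ≤ K e^{-β₀ ∑|x_k - t v_k|²} e^{-b H(Z)}` for all `Z` — hypothesis
`htr` of `abs_duhamelChain_le_dispersive_of_le` for the good-set transport
`(t, g) ↦ 1_{good} · hsTransport Φ t g` of the BBGKY hierarchy in `ℝ^d`.
[cite: CIP1994, §4.5 (5.2)–(5.3)] -/
theorem _root_.Literature.Analysis.FluidPDE.HardSphereFlow.abs_indicator_hsTransport_le_dispersive
    (Φ : HardSphereFlow (Euclidean.geometry d) ε s) {b β₀ τ t K : ℝ} (hβ₀ : 0 ≤ β₀)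
    (hτ : 0 ≤ τ) (hτt : τ ≤ t) (hK : 0 ≤ K) {g : Config s d (EuclideanSpace ℝ d) → ℝ}
    (hg : ∀ Z, |g Z| ≤ K * (Real.exp (-β₀ * ∑ k, ‖(Z k).1 - τ • (Z k).2‖ ^ 2) *
      Real.exp (-b * configEnergy Z)))
    (Z : Config s d (EuclideanSpace ℝ d)) :
    |Φ.good.indicator (hsTransport Φ (t - τ) g) Z| ≤
      K * (Real.exp (-β₀ * ∑ k, ‖(Z k).1 - t • (Z k).2‖ ^ 2) * Real.exp (-b * configEnergy Z)) := by
  by_cases hZ : Z ∈ Φ.good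
  swap
  · rw [indicator_of_notMem hZ, abs_zero]
    positivity
  rw [indicator_of_mem hZ, hsTransport_apply]
  -- the orbit through `Φ_{-t} Z` is a hard-sphere trajectory passing through the two points
  set γ : ℝ → Config s d (EuclideanSpace ℝ d) := fun a => Φ.flow a (Φ.flow (-t) Z) with hγ
  have hgood : Φ.flow (-t) Z ∈ Φ.good := Φ.mapsTo_good (-t) hZ
  have htraj : IsHardSphereTrajectory (Euclidean.geometry d) ε s γ := Φ.isTrajectory _ hgood
  have hγτ : γ τ = Φ.flow (-(t - τ)) Z := Φ.flow_flow_neg_eq hZ τ t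
  have hγt : γ t = Z := by
    have h := Φ.flow_flow_neg_eq hZ t t
    rw [sub_self, neg_zero, Φ.flow_zero Z hZ] at h
    exact h
  -- Lemma 4.2.4 and energy conservation along this trajectory
  have hdisp := htraj.sum_norm_sq_sub_smul_le_of_le hτ hτt
  rw [hγτ, hγt] at hdisp
  have hE : configEnergy (Φ.flow (-(t - τ)) Z) = configEnergy Z := by
    have h := IsHardSphereTrajectory.configEnergy_eq_holds htraj τ t
    rwa [hγτ, hγt] at h
  refine (hg _).trans ?_
  rw [hE]
  refine mul_le_mul_of_nonneg_left (mul_le_mul_of_nonneg_right (Real.exp_le_exp.2 ?_)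
    (Real.exp_pos _).le) hK
  exact mul_le_mul_of_nonpos_left hdisp (by linarith)

end

end Literature.MathematicalPhysics.KineticTheory
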